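import Literature.NumberTheory.DiophantineGeometry.GenEllDeBadPlaceDefect
import Literature.NumberTheory.DiophantineGeometry.GenEllDeCritDivisibility
import HarnessLib

/-!
# [GenEll] Thm 2.1 on `D_e`: the defect inequality at every place, from the critical values alone
# (junction (F-b) ∘ (S1)(B) of the R-b-with-defects route)

Support file (proof-only, no definitions) for the abc-iut cell's route item `GenEllTwo`
(stmt-ABC-19679; [GenEll] = S. Mochizuki, *Arithmetic elliptic curves in general position*, Math. J.
Okayama Univ. **52** (2010), Thm. 2.1 (ii) ⇒ (i), proof pp. 12–13, the «sharp Prop. 1.6» step on the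
auxiliary curve).  Classical and undisputed; nothing here bears on [IUTchIII] Cor. 3.12.

`GenEll.DeC.exists_defect_toNat_ord_le` (abc-iut-w5-d090, `GenEllDeBadPlaceDefect.lean`) bounds
`ord⁺_w N_c` by `Σ_{β∈A} ord⁺_w(t_c − β) + D·e(w∣p)` at EVERY place, GIVEN the pointwise divisibility
identity `∏_{β∈A}(s + c·r^{k+2} − β·rs) = N_c·(H₀(r) + s·H₁(r))`; `GenEll.DeC.exists_prod_fibre_eq_N_mul'`
(abc-iut-w5-d054, `GenEllDeCritDivisibility.lean`) PRODUCES that identity from the Dedekind-ring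
divisibility `N_c ∣ ∏_β (T − β·U)` in `K[D_e]` as soon as `R_c` splits in `K` and `A` contains every
critical value `tCritC k c θ`.  This file composes the two: the consumer (the `hκ` discharge of the
mechanism, `GenEllMechanismKappa`) gets the defect inequality with NO cofactor polynomials and NO identity
hypothesis in its interface — only `(p, k ≥ 1, c ≠ 0, A ⊇ crit(t_c), R_c split in K)`.
[cite: MochizukiGenEll2010, Thm 2.1 proof pp.12-13]
-/

noncomputable section

open NumberField IsDedekindDomain Polynomial Finset
open Literature.IUT.LogVolume

namespace Literature.NumberTheory.DiophantineGeometry.GenEll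

universe u v

/-- **The defect inequality at every place, from the critical values** ([GenEll] Thm. 2.1 on `D_e`,
R-b with defects): for `k ≥ 1`, `c ≠ 0` in a number field `K` in which the critical-locus polynomial
`R_c` (`DeCrit.RpolyC`) splits, and a finite `A ⊂ K` containing every critical value
`DeCrit.tCritC k c θ` (`θ` a root of `R_c`), there is `D ∈ ℕ` such that for EVERY number field
`L ⊇ K`, EVERY place `w ∣ p` and EVERY point of `D_e(L) ∖ {rs = 0}` with `N_c ≠ 0` and `t ∉ A`:
`ord⁺_w N_c ≤ Σ_{β∈A} ord⁺_w(t − β) + D·e(w∣p)` — no separation, no reduction hypothesis, any prime `p`.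
[cite: MochizukiGenEll2010, Thm 2.1 proof pp.12-13] -/
theorem DeC.exists_defect_toNat_ord_le_of_crit (p : ℕ) [Fact p.Prime] (k : ℕ) (hk : 1 ≤ k)
    {K : Type u} [Field K] [NumberField K] {c : K} (hc : c ≠ 0) (A : Finset K)
    (hsplit : (DeCrit.RpolyC k c).Splits)
    (hA : ∀ θ : K, (DeCrit.RpolyC k c).eval θ = 0 → DeCrit.tCritC k c θ ∈ A) :
    ∃ D : ℕ, ∀ (L : Type v) [Field L] [NumberField L] [Algebra K L]
      (w : HeightOneSpectrum (𝓞 L)), w ∈ placesOver L p → ∀ (r s t N : L),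
      s ^ 2 = 1 - 4 * r ^ (2 * k + 1) → t * (r * s) = s + algebraMap K L c * r ^ (k + 2) →
      N = -s ^ 3 + algebraMap K L c * ((k + 1) * r ^ (k + 2) - 2 * r ^ (3 * k + 3)) →
      r ≠ 0 → s ≠ 0 → N ≠ 0 → (∀ β ∈ A, t ≠ algebraMap K L β) →
      (ord L w N).toNat ≤ (∑ β ∈ A, (ord L w (t - algebraMap K L β)).toNat) + D * ramIdx L w := by
  obtain ⟨H₀, H₁, hH⟩ :
      ∃ H₀ H₁ : K[X], ∀ (L : Type v) [CommRing L] [Algebra K L] (r s N : L),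
        s ^ 2 = 1 - 4 * r ^ (2 * k + 1) →
          N = -s ^ 3 + algebraMap K L c * ((k + 1) * r ^ (k + 2) - 2 * r ^ (3 * k + 3)) →
            ∏ β ∈ A, (s + algebraMap K L c * r ^ (k + 2) - algebraMap K L β * (r * s)) =
              N * (aeval r (H₀.map (algebraMap K L)) + s * aeval r (H₁.map (algebraMap K L))) :=
    DeC.exists_prod_fibre_eq_N_mul' k hc A hsplit hA
  obtain ⟨D, hD⟩ := DeC.exists_defect_toNat_ord_le (K := K) p k hk hc A H₀ H₁
  refine ⟨D, fun L _ _ _ w hw r s t N hcurve ht hN hr hs hN0 htA => ?_⟩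
  exact hD L w hw r s t N hcurve ht hN hr hs hN0 htA (hH L r s N hcurve hN)

/-- The same with the `t`-free fibre forms: since `t·(rs) = s + c·r^{k+2}`, the consumer who carries
`t` only implicitly may read `ord⁺_w(t − β)` as `ord⁺_w((s + c·r^{k+2} − β·rs)/(rs))`; here we record the
equality of the two fibre forms used to pass between them. [cite: MochizukiGenEll2010, Thm 2.1 proof pp.12-13] -/
theorem DeC.fibreForm_eq_sub_mul {L : Type v} [Field L] (k : ℕ) {c' r s t : L} (β : L)
    (ht : t * (r * s) = s + c' * r ^ (k + 2)) :
    s + c' * r ^ (k + 2) - β * (r * s) = (t - β) * (r * s) := by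
  linear_combination -ht

end Literature.NumberTheory.DiophantineGeometry.GenEll
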